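import Mathlib
import Literature.Computability.QuantumComplexity.GaussianRank
import Summits.QuantumAdvantage.QuantumAdvantage.Theses.SpinorFlattening
import Summits.QuantumAdvantage.QuantumAdvantage.Theorems.GaussRankTwoCopies.Negative.TightFour

/-!
# Line `clifford-monoid-pencil` — CHECKED skeleton for the crux `SpinorFlattening.GaussRankTwoCopies`
# (stmt-QuantumAdvantage-1248; route `route-QuantumAdvantage-SpinorFlattening`, rank-5 crux `χ_G(M⊗M) ≥ 4`)

crux-plan, generation 2 (`planner-cruxplan-stmt-QuantumAdvantage-1248-clifford-monoid-penc-g2-0`, 2026-08-16),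
superseding generation 1 (`…-clifford-monoid-penc-0`, same day, same path; its stub registration on the item was
overwritten within the second by a sibling line's registration — the item keeps ONE skeleton slot — which is why a
second generation was seated). Idea card `Cruxes/GaussRankTwoCopies/Ideas/clifford-monoid-pencil.md` (crux-ideate
r1, ideator 3); triage r1-1 / r1-2 / r1-3: pass × 3 ("`TopStratumFree` TRUE, re-derived; a correct PARTIAL line:
top stratum + (4,4,1)/(4,4,0e)/(4,4,0o); remaining strata open; sharpen: det-form `TopStratumFree` as a standalone
lemma, drop the sign-sensitive Choi dictionary `CutSimilitude`, use `u, w ∈ one maximal torus ⇒ D diagonal`").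
Line card: `Cruxes/GaussRankTwoCopies/Lines/clifford-monoid-pencil.md`.

## What generation 2 changed (mathematics unchanged; every proof below re-checked, rc 0)

* S1 is now NAMED AND TYPED IDENTICALLY to the sibling skeletons' parity stub (`stub_gaussianParity`, same
  signature as `Lines/lagrangian-triple-rigidity.lean` S1 and `Lines/e8-cartan-quotient.lean` S1 over a
  definitionally identical `evenProj`), and S2 `stub_twoTermFree` carries the sibling's binder names, so that ONE
  landing of each shared obligation matches whichever skeleton currently occupies the item's registration slot.
* The predicate `InCliffordGroup` is GONE as a declaration: membership in `Γ⁰` is spelled out INLINE in S3's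
  conclusion and S4's hypotheses (invertible ∧ parity-commuting ∧ normalises the Majorana span). Reason: the
  tree audit classes every untagged `Prop`-valued def/structure under `Summits/` as `tree.vendored-fact`
  (D-0027 §2.1) — generation 1's `structure InCliffordGroup : Prop` would have blocked the verbatim landing of
  S3/S4; the remaining §1 vocabulary is data-valued (`def` class, lands clean).
* Docstrings of S5/S7 sharpened by this seat's re-derivation: which (4,4,k) sub-configurations survive the
  isotropy constraints alone (so the fibre coupling is genuinely needed), and WHY the lower strata are stated at
  the state level with the exact target `|M⟩^{⊗2}` — the matrix-level strengthening "a rank-one value of a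
  boundary pencil has a null ROW" is FALSE (explicit mechanism in S7's docstring), only "column AND row non-null
  is impossible" is true, and that is the crux restricted to the stratum.

## The line in one paragraph

Read an 8-qubit vector `ψ` as its 16 × 16 CUT MATRIX `Ψ[x][y] = ψ(x ++ y)` across the 4|4 cut (`cutMatrix`).
The cut matrix of `|M⟩^{⊗2}` is the rank-one matrix `½ m mᵀ`, `m = |0000⟩ + |1111⟩` (`cutMatrix_magicMPow_two`,
PROVED), and `m` is NOT a null vector of the block's `Spin(8)`-invariant form `β = XYXY`: `β(m,m) = −2`
(`bilin_mvec`, PROVED) — this is `|M⟩` being non-Gaussian. Even Gaussian states are the closed cone over the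
conformal spin group acting on `Δ(8) = ℂ¹⁶` (fermionic Choi–Jamiołkowski; Neretin's category of Lagrangian
relations): a Gaussian with INVERTIBLE cut matrix is an invertible Gaussian operator, and for two of them the
relative operator `U = Ψ'⁻¹Ψ` is an element of the even Clifford group `Γ⁰ = ℂ^×·Spin(8)` of block `B` — stated
here INTRINSICALLY and INLINE (invertible, commutes with the parity `Z^{⊗4}`, normalises the span of the eight
block Majoranas; `stub_cutCliffordGroup`, the dictionary, derived by CAR transport with no sign conventions to
choose). LEVER (`stub_pencil`, load-bearing): a pencil `a₁U₁ + a₂U₂ + a₃·1` of two elements of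
`Γ⁰` that equals a nonzero rank-one matrix `u wᵀ` has a NULL column and a NULL row — divide by a term, read the
odd block (`a₁U₁₋ + a₂U₂₋ + a₃ = 0` forces `S + S⁻¹ = μ`: semisimple `(4/4)`-type in a common one-torus, or
unipotent `±(1+N)`, `N² = 0`), transfer to the even block through the `D₄` weights / triality (`(1,6,1)` or
`(4,4)` eigenspace patterns; `span{1, N₊, N₊²}`), where rank one is possible only as a projector onto a
nonzero-weight LINE or as `γN₊²` for `[3,1⁵]`. The TOP STRATUM (all three cut matrices invertible = the card's
`TopStratumFree`, Disproof §4(6)'s first live stratum `(4,4,4)`) is then a COMPOSITION LEMMA proved in this file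
(`topStratum_of`: cut the equation, left-multiply by `Ψ₂⁻¹`, apply the pencil lemma to the row `m`). The
remaining strata are split by the number of invertible cut matrices: exactly two (`stub_facetStratum`, the
`(4,4,k)` faces: `k ∈ {1,0e,0o}` dead by the same pencil, `k ∈ {3,2}` reduced to the fibre of the face map),
exactly one (`stub_oneInvertibleStratum`: a rank count leaves only `(4,3,3)`), none (`stub_boundaryStratum`:
HARDEST, open — two-sided `CSpin(8)²` normal forms of face pairs). Parity and short decompositions are disposed
of first: every Gaussian is even or odd (`stub_gaussianParity`, SHARED verbatim with the sibling lines) and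
`M⊗M` is not a sum of two Gaussians (`stub_twoTermFree` = `χ_G ≥ 3`, an instance of the route's support item
`FlatteningBoundExact`; SHARED verbatim), so the even projection of any decomposition with an odd term or a zero
coefficient is already excluded.

## Composition (kernel-checked, no `sorry` of its own)

`GaussRankTwoCopies_of : GaussRankTwoCopies := fun a g hg heq ↦ crux_of_stubs S1 … S7 a g hg heq`, where
`crux_of_stubs` takes the seven stub STATEMENTS as hypotheses and is PROVED here: `even_redecomposition` (S1 ⇒
the even projection of a 3-term Gaussian sum is a 3-term EVEN Gaussian sum; `evenProj_magicMPow_two` by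
`decide` on 8 bits) → `false_of_zero_coeff` (a zero coefficient leaves a `Fin 2` sum, `Fin.sum_univ_succAbove`;
S2) → `fin3_split` (3 / 2 / 1 / 0 invertible cut matrices) → **`topStratum_of` (S3 + S4 ⇒ no decomposition
with three invertible cut matrices)** via `cutMatrix_sum_three`, `cutMatrix_magicMPow_two`,
`Matrix.nonsing_inv_mul`, `mul_vecMulVec`, `bilin_mvec` | S5 | S6 | S7. Dependency DAG: S1 → even
re-decomposition; S2 → short sums; (S3, S4) → top stratum; S5, S6, S7 → the three lower regimes; all → crux.

## Vocabulary policy (for the lead)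

§1 holds eight short DATA definitions over tree vocabulary (`glue`/`cutMatrix` — the Choi reshaping, written
with a `dite` on the wire index so that `decide` evaluates it; `majv`; `parityOp = ZZZZ`; `chargeConj = XYXY`;
`bilin`; `evenProj`; `mvec`) and NO Prop-valued definition (membership in `Γ⁰` is inlined, see above). They
are written to be landed VERBATIM as a definitions-only support module (suggested
`Theorems/SpinorFlatteningGaussRankTwoCopiesMonoidDefs.lean --supports stmt-QuantumAdvantage-1248`), after which
every stub lands verbatim by name + signature; `majv` and `evenProj` are character-for-character the sibling
lines' definitions (`Lines/lagrangian-triple-rigidity.lean` §1), so a shared module serves all three lines.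
Conventions = the item's evidence codes: JW Majoranas `majorana 4 j b` / `majorana (2*4) j b` of
`GaussianRank.lean`, `C = XYXY` (triage j010601 C0; CHECKS.md r1-2: `C c_k = c_kᵀ C`, `C² = 1`), block `A` =
wires 0–3 = rows, block `B` = wires 4–7 = columns (Disproof §4, Ideator3Sketch `cutMatrix`).
NOTHING in the registered stubs depends on a sign convention: the only dictionary statement (S3) is intrinsic,
and the only numerical input (`β(m,m) = −2`) is PROVED here.

## Disproof.lean used (tree `Cruxes/GaussRankTwoCopies/Disproof.lean`, cdisprove gen 1 + 2, read in full at 04:00Z)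

* §1 `false_without_gaussianity` / `false_without_linearIndependence` (landed as
  `Negative.TightFour.gaussRankTwoCopies_false_without_*`, IMPORTED above): honoured at S1 (EIGHT independent
  annihilators ⇒ maximal isotropic ⇒ one vacuum line ⇒ parity; with `A = 0` allowed `|+⟩`-type vectors qualify
  and S1 is false) and at S3 (`dim 𝓛 = 8` is exactly what makes the annihilator space of a type-4 state a GRAPH
  both ways, i.e. what puts `Ψ'⁻¹Ψ` in the Clifford group; with fewer rows `U` need not normalise anything);
  with the predicate dropped, `M⊗M` itself is a 1-term sum and indeed `cut(M⊗M) = ½ m mᵀ` is singular, outside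
  every stratum with an invertible term.
* §2 `not_twoCopiesBound_four` / landed `gaussRankTwoCopies_tight_four`: respected — the four Fock corners
  `½|c⁴d⁴⟩` are four boundary (type-0e) terms; S4 is a statement about pencils of TWO group elements plus the
  identity (three terms), and nothing here bounds four terms.
* §4(5)–(6) strata census: this line's strata are the Disproof's cut types (`k` = number of BCS pairs ⇔
  `rank Ψ = 2^k`, type 4 ⇔ `Ψ` invertible); `topStratum_of` closes the first LIVE stratum `(4,4,4)` of §4(6)
  ("non-semisimple (unipotent) configurations NOT yet excluded" — S4's docstring covers them); S5 re-proves the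
  DEAD `(4,4,0e)` (parity twin = centre of `Spin(8)`) and `(4,4,0o)` (determinant obstruction =
  "`rank(R ∓ 1) = 1` never happens in `SO(8)`") and owns the live `(4,4,3)`, `(4,4,2)`, `(4,4,1)`; S6 owns
  `(4,3,3)` (the others die by §4(5)'s last bullet); S7 owns `(3,3,3)`, `(3,3,2)`, `(3,3,1)`, `(3,2,2)`,
  `(2,2,2)`, `(2,2,1)`, `(3,3,0o)` (live) and `(3,3,0e)`, `(2,2,0x)`, products (dead by hand).
* §4(6b) "no E-sector-only certificate": honoured — S4 reads the ODD block first (`Σ aᵢUᵢ₋ + a₃ = 0`) and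
  transfers to the even block through the chirality coupling `U = (U₊, U₋)` of ONE group element; nothing is
  claimed from the even block alone.
* §5 `Parity.gaussianRank_not_multiplicative` (landed): honoured — parity is the FIRST step (S1 + even
  re-decomposition); S4's hypotheses include parity-commutation of `U₁, U₂`; no stub is an instance of the
  refuted multiplicativity (checked against `Negative/TightFour.lean`, the only landed Negative module).
* §6 (gen 2) `magicM_annihilator_eq_zero` / `magicM_not_isGaussian`: the same fact in this line's language is
  `β(m,m) ≠ 0` (`bilin_mvec`, proved here independently); `magicMPow_two_annihilator_eq_zero` is what makes
  `cut(M⊗M)` have no left/right Majorana annihilator.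
* §7 stub audit: "`TopStratumFree` TRUE (panel ×3); `CutSimilitude`'s sign `μ = −λ` under kit j008398" —
  j008398's summary never attached to the item (owner-private job), so this skeleton contains NO statement whose
  truth depends on that sign: `CutSimilitude` is replaced by the intrinsic S3.
* §9/§9b: exact rank settled on paper ×4 by other lines; this line is the MONOID/strata engine and the only one
  whose first theorem (`topStratum_of`) is already a kernel-checked reduction to two clean lemmas.
  `ledger negatives --problem QuantumAdvantage` (1615, 2202, 8592, 9863): unrelated.

## Triage answers acted on

* r1-2 / r1-3 "restate `TopStratumFree` over `cutMatrix` with the invertibility hypothesis (det of the 16×16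
  Choi matrix); land it as a standalone lemma": DONE, and strengthened — the top stratum is no longer a stub but
  a PROVED composition of S3 (dictionary) + S4 (pencil), each independently attackable.
* r1-2 "drop the Choi dictionary (`CutSimilitude`, sign-sensitive) from the plan": DONE — S3 is intrinsic
  (normaliser of the Majorana span + parity), derived by CAR transport; no `ρ±`, no `λ/μ` signs.
* r1-3 "replace the `(4,4)/(1,6,1)` pattern analysis by `u, w ∈ one maximal torus ⇒ D diagonal in a weight
  basis ⇒ rank-1 D has a pure column`": ADOPTED as the proof plan of S4 (docstring), with the unipotent pencils
  kept for `μ = ±2`.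
* r1-1 / r1-2 / r1-3 "remaining faces = finite programme, subsumed in outcome by lagrangian-triple-rigidity":
  made explicit as three named regimes S5 / S6 / S7 with their exact status (partial / one stratum / open), so
  the lead can staff or swap them individually; S1 and S2 are SHARED obligations with the other lines, now with
  identical names and signatures.
-/

noncomputable section

namespace Summit.QuantumAdvantage.QuantumAdvantage.Cruxes.GaussRankTwoCopies.CliffordMonoidPencil

set_option linter.dupNamespace false

open Literature.Computability.QuantumComplexity Literature.Computability.Cryptography Matrix
open scoped BigOperators

/-! ## §1 Vocabulary (data only; tree conventions; no Prop-valued definitions) -/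

/-- Glue a block-`A` label (wires 0–3) and a block-`B` label (wires 4–7) into an 8-wire label
(`dite` on the wire index: kernel-evaluable, no `Fin.append` casts). -/
def glue (x y : QReg 4) : QReg (2 * 4) :=
  fun w => if h : w.val < 4 then x ⟨w.val, h⟩ else y ⟨w.val - 4, by have := w.isLt; omega⟩

/-- The CUT (Choi) MATRIX of an 8-qubit vector across the 4|4 cut: rows = block `A` strings,
columns = block `B` strings, `Ψ[x][y] = ψ(x ++ y)`. -/
def cutMatrix (ψ : QReg (2 * 4) → ℂ) : Matrix (QReg 4) (QReg 4) ℂ :=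
  Matrix.of fun x y => ψ (glue x y)

/-- The Clifford element `c(v) = Σ_p v_p c_p` of a coefficient vector `v ∈ ℂ^{2n}` (tree Majoranas; character-for-
character the sibling lines' `majv`). -/
def majv (n : ℕ) (v : Fin n × Bool → ℂ) : Matrix (QReg n) (QReg n) ℂ :=
  ∑ p : Fin n × Bool, v p • majorana n p.1 p.2

/-- Fermion parity on one block: `P = Z ⊗ Z ⊗ Z ⊗ Z = diag((-1)^{|x|})` (`∝ c₁c₂⋯c₈`). -/
def parityOp : Matrix (QReg 4) (QReg 4) ℂ :=
  pauliString ![Pauli.Z, Pauli.Z, Pauli.Z, Pauli.Z]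

/-- Charge conjugation on one block: `C₄ = X ⊗ Y ⊗ X ⊗ Y` (`C c_p C = c_pᵀ` for the eight block
Majoranas, `C² = 1`, `Cᵀ = C`, parity-preserving): the matrix of the `Spin(8)`-invariant symmetric
bilinear form `β` on `Δ(8) = ℂ^{16}` (pairs `Δ₊` with `Δ₊` and `Δ₋` with `Δ₋`). Same `C` as the item's
evidence codes (`C = XYXY…`, triage j010601 C0, CHECKS.md r1-2). -/
def chargeConj : Matrix (QReg 4) (QReg 4) ℂ :=
  pauliString ![Pauli.X, Pauli.Y, Pauli.X, Pauli.Y]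

/-- `β(u, w) = uᵀ C₄ w`. Pure spinors of `Spin(8)` of either chirality are exactly the NULL vectors of
`β` of definite parity (Cartan; dimension 8); `β(m, m) = -2 ≠ 0` for `m = |0000⟩ + |1111⟩ = √2 |M⟩`. -/
def bilin (u w : QReg 4 → ℂ) : ℂ := u ⬝ᵥ (chargeConj *ᵥ w)

/-! ### Membership in the even Clifford group (INLINED in S3/S4; no declaration)

`U ∈ Γ⁰ = ℂ^× · Spin(8, ℂ) ⊂ GL(Δ(8)) = GL₁₆(ℂ)` is written, intrinsically (no choice of `ρ±`, no signs), as
the three clauses `IsUnit U.det`, `U * parityOp = parityOp * U` (even: commutes with `Z ⊗ Z ⊗ Z ⊗ Z`) and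
`∀ v, ∃ v', U * majv 4 v = majv 4 v' * U` (normalises the Majorana span, `U c(v) = c(v') U`). Every such `U`
is `t · s`, `s ∈ Spin(8)`: `v ↦ v'` is well defined and linear by `linearIndependent_majorana`, bijective since
`U` is invertible, orthogonal since `c(v)² = (v·v)1`; it lifts to `Pin(8)`, the quotient centralises
`Cl(8) = M₁₆(ℂ)` hence is a scalar, and parity-commuting = even. `Γ⁰` is stable under transpose
(`c_pᵀ = ±c_p`). No `def … : Prop` is introduced: under `Summits/` an untagged Prop-valued definition is a
`tree.vendored-fact` (D-0027 §2.1) and would block the verbatim landing of the stubs. -/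

/-- Projection onto the even-parity sector of 8 qubits (amplitudes on even-weight strings; character-for-character
the sibling lines' `evenProj`). -/
def evenProj (ψ : QReg (2 * 4) → ℂ) : QReg (2 * 4) → ℂ :=
  fun x => if (Finset.univ.filter (fun i => x i = true)).card % 2 = 0 then ψ x else 0

/-- The unnormalised GHZ₄ vector `m = |0000⟩ + |1111⟩ = √2 · |M⟩` of one block. -/
def mvec : QReg 4 → ℂ :=
  basisState (fun _ => false) + basisState (fun _ => true)

/-! ## §2 Registered stubs (the only `sorry`s of the line) -/

/-- **S1 `stub_gaussianParity`** [M; CAR algebra; SHARED obligation — identical name and signature in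
`Lines/lagrangian-triple-rigidity.lean` S1 and `Lines/e8-cartan-quotient.lean` S1; prove ONCE]. Every Gaussian
state on 8 qubits is even or odd. WHY TRUE: the annihilator space `L = {v : c(v) g = 0}` of `g ≠ 0` is
isotropic (`c(v)² = (v·v)1`) and has dimension `8` (EIGHT independent rows — Disproof §1
`false_without_linearIndependence` is spent here: with `A = 0` allowed, mixed-parity vectors qualify and S1
fails), hence is maximal isotropic with a ONE-dimensional joint kernel (irreducibility of the Clifford module =
vacuum uniqueness); the parity operator `∏ⱼ(−i c_{j,X}c_{j,Y})` anticommutes with every `c(v)`, so it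
preserves `ker c(L) = ℂg`: `Pg = ±g`. LEANS ON: `majorana_anticommutator`, `majorana_mul_majorana_of_ne`,
`linearIndependent_majorana` (tree). -/
theorem stub_gaussianParity :
    ∀ g : QReg (2 * 4) → ℂ, IsGaussian g → evenProj g = g ∨ evenProj g = 0 := by
  sorry

/-- **S2 `stub_twoTermFree`** [M; `χ_G(M⊗M) ≥ 3`; SHARED obligation — identical name and signature in
`Lines/lagrangian-triple-rigidity.lean` S5]. `|M⟩^{⊗2}` is not a combination of TWO Gaussian states
(= Disproof §0 `TwoCopiesBound IsGaussian 2`). WHY TRUE, three independent proofs on the record: (a) the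
`K = 2` Clifford flattening — route support item `FlatteningBoundExact` (stmt-QuantumAdvantage-1249) at
`(t, K, r) = (2, 2, 2)`: `2 · D₂(8) = 58 < 64 = C(2,2)·8²` (hand-verified ×4 in route review; once
`FlatteningBoundExact` lands this stub is its one-line instance); (b) this line's own pencil: two type-4
terms give `a·1 + b·U = Ψ⁻¹(m⊗m)` of rank one, impossible for `U ∈ Γ⁰` (S4 with `a₁ = 0`); a type-4 term
plus a singular one has `rank(m⊗m − aΨ) ≥ 15 > 8`; two singular terms: `(3,3)` forces `O₂ ∥ O₁`, Disproof
§4(5); (c) lagrangian-triple-rigidity Case D counts `13/22/27/16 > 10`. Used by the composition to dispose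
of zero coefficients AND of odd terms (even projection of a 3-term sum with an odd term is a 2-term sum). -/
theorem stub_twoTermFree :
    ∀ (b : Fin 2 → ℂ) (h : Fin 2 → QReg (2 * 4) → ℂ), (∀ i, IsGaussian (h i)) →
      magicMPow 2 ≠ ∑ i, b i • h i := by
  sorry

/-- **S3 `stub_cutCliffordGroup`** [M/L; THE DICTIONARY, intrinsic form — fermionic Choi–Jamiołkowski].
For two EVEN Gaussian states `g, g'` on 8 qubits whose cut matrices `Ψ, Ψ'` are invertible (cut type 4 =
four BCS pairs across the cut), the relative operator `U = Ψ'⁻¹Ψ ∈ End(Δ_B)` lies in the even Clifford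
group of block `B`. WHY TRUE (CAR transport, no signs to choose): block-`A` Majoranas act on cut matrices
by `cut(c_{A}(v) ψ) = c₄(v) · cut ψ`, block-`B` ones by `cut(c_{B}(w) ψ) = P · cut ψ · c₄(w)ᵀ` (the
Jordan–Wigner string through block `A` is the parity sign `P = Z^{⊗4}` on the row index); the annihilator
space `𝓛 = {(v,w) : (c_A(v) + c_B(w)) g = 0}` has dimension `8` and, `Ψ` being invertible, meets
`V_A ⊕ 0` and `0 ⊕ V_B` trivially (`c₄(v)Ψ = 0 ⇒ c₄(v) = 0 ⇒ v = 0` by `linearIndependent_majorana`), so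
it is the graph of an invertible `S : V_B → V_A`: `c₄(Sw) Ψ = −P Ψ c₄(w)ᵀ` for all `w`; the same for
`g'` with `S'`; hence `U c₄(w)ᵀ = c₄(S'⁻¹S w)ᵀ U`, and `c₄(w)ᵀ = c₄(w̃)` (`X`-parts symmetric, `Y`-parts
antisymmetric). Parity: `g` even ⇒ `P Ψ = Ψ P`, so `U` commutes with `P`. (`det U` is a unit trivially — `det_mul`,
`isUnit_nonsing_inv_det` — and is therefore NOT part of the conclusion; the composition supplies it.)
COROLLARY used by S5's plan (no extra stub): for `g` even Gaussian of ANY cut type, `Ψ'⁻¹Ψ` lies in the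
CLOSURE `M̄⁰` of `Γ⁰` (type 4 is dense in the even spinor cone), and a singular element of `M̄⁰` has totally
`β`-isotropic image and row space (`β(xu,xv) = τβ(u,v)` with `τ = 0` iff `x` is singular; transpose).
LEANS ON: `majorana_apply` / `majorana_mul_majorana_of_ne` / `linearIndependent_majorana` (tree),
`Matrix.nonsing_inv_mul`, `Submodule.finrank` bookkeeping (an injective linear map between 8-dimensional
spaces is surjective). -/
theorem stub_cutCliffordGroup :
    ∀ g g' : QReg (2 * 4) → ℂ, IsGaussian g → IsGaussian g' → evenProj g = g → evenProj g' = g' →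
      IsUnit (cutMatrix g).det → IsUnit (cutMatrix g').det →
        ((cutMatrix g')⁻¹ * cutMatrix g) * parityOp = parityOp * ((cutMatrix g')⁻¹ * cutMatrix g) ∧
          ∀ v : Fin 4 × Bool → ℂ, ∃ v' : Fin 4 × Bool → ℂ,
            ((cutMatrix g')⁻¹ * cutMatrix g) * majv 4 v = majv 4 v' * ((cutMatrix g')⁻¹ * cutMatrix g) := by
  sorry

/-- **S4 `stub_pencil`** [L; THE LOAD-BEARING LEVER — the Clifford-monoid pencil, top stratum]. If a
linear pencil of two even Clifford-group elements and the identity is a nonzero RANK-ONE matrix `u wᵀ`,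
then its column `u` and its row `w` are `β`-NULL (pure spinors). WHY TRUE (card + three independent
triage re-derivations + two planner re-derivations in the present normalised form): degenerate coefficients
first — `u wᵀ ≠ 0`, so not all `aᵢ` vanish; one nonzero `aᵢ` gives rank 16; `a₃ = 0 ≠ a₁a₂` reduces by `U₂⁻¹`
to `bU + c·1` (`b c ≠ 0`), and `a₁a₂ = 0 ≠ a₃` is `bU + c·1` directly: its odd (or even) block `bU₋ + c = 0`
makes `ρ₋(s)` scalar, `s` central, `U = t·(±1 ⊕ ±1)`, the other block `t b(ε₊ − ε₋)·1` of rank 0 or 8 —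
never 1. Parity — `u wᵀ` commutes with `P`, so `Pu = εu`, `Pw = εw` (a rank-one identity `(Pu)wᵀ =
u(Pw)ᵀ`), mixed parity being `u wᵀ = 0`; conjugating by `c₁` (an automorphism preserving `Γ⁰` and
`β`-nullity, `C c₁ᵀ C = c₁`) WLOG both even, so the ODD block reads `a₁U₁₋ + a₂U₂₋ + a₃ = 0`, a linear
relation among similitudes of `(Δ₋, β₋)`; with `a₁a₂a₃ ≠ 0` it forces `S₂₋ + S₂₋⁻¹ = μ·1` (`Uᵢ = tᵢSᵢ`,
`Sᵢ ∈ Spin(8)`, similitude algebra `(βB+γ)*(βB+γ) = α²`) and `S₁₋ ∈ span(1, S₂₋)`: SEMISIMPLE case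
(`μ ≠ ±2`): `S₂₋ = λP_L + λ⁻¹P_{L'}` on complementary Lagrangians (eigenspaces of an orthogonal map with
`λ² ≠ 1` are isotropic), `S₁₋` in the same rank-one torus, so `S₁, S₂ ∈ T̂·ker ρ₋` for a one-dimensional
torus `T̂ ⊂ Spin(8)` (`ker ρ₋ = {1, −ω}` acts by `±1` on `Δ₊`) and `D := a₁U₁₊ + a₂U₂₊ + a₃` acts by
SCALARS on the `T̂`-weight spaces of `Δ₊`, of dimensions `(1,6,1)` (cocharacter `W·(1,1,1,1)`) or `(4,4)`
(`W·2e₁`) — these are the only cocharacters pairing to `±1` with all eight `Δ₋`-weights — so rank one forces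
`D` = projector onto a nonzero-weight LINE, whose vector and covector are `β`-null (a torus weight vector of
nonzero weight is null; the dual covector is `β(e_{−χ}, ·)`); UNIPOTENT case (`μ = ±2`): `S₂₋ = ±(1+N)`,
`N ∈ so(Δ₋)`, `N² = 0` (`[2²1⁴]` or `[2⁴]`), so `D ∈ span{1, N₊, N₊²}` with `N₊ ∈ {[2²1⁴],[2⁴],[3,1⁵]}`
(triality: `[2²1⁴]` fixed, `{[3,1⁵],[2⁴]_I,[2⁴]_II}` permuted), `D = x + yN₊ + zN₊²` has rank 8 if
`x ≠ 0`, rank `rank N₊ ≥ 2` if `x = 0 ≠ y`, so rank one only as `zN₊²` for `[3,1⁵]`, whose image/coimage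
is a null line (`β(N²a, N²a) = β(a, N⁴a) = 0`). LEANS ON (Mathlib): `Module.End.eigenspace`,
`IsNilpotent`-style linear algebra over `Matrix (QReg 4) (QReg 4) ℂ`, `Matrix.rank`; the `Spin(8)` facts
enter only through the three inlined `Γ⁰` clauses (orthogonality of the induced `8 × 8` map on `span{c_p}`,
the two half-spin blocks, centre `{±1, ±ω}`, `rank(S ∓ 1)` even for `S ∈ SO(8,ℂ)`); Chevalley 1954 III, Porteous
1995 ch. 24, Collingwood–McGovern §5–6 (nilpotent orbits of `D₄`). TIGHT: the `[3,1⁵]` pencil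
`2U(1) − U(2) − 1 = −N²` (`U(y) = exp(yN)`) IS rank one with null column `|0000⟩` and null row `⟨1111|`
(gen-1 exact check P1), so "rank one is impossible" would be FALSE — the conclusion is exactly nullity. -/
theorem stub_pencil :
    ∀ (U₁ U₂ : Matrix (QReg 4) (QReg 4) ℂ),
      IsUnit U₁.det → U₁ * parityOp = parityOp * U₁ →
        (∀ v : Fin 4 × Bool → ℂ, ∃ v' : Fin 4 × Bool → ℂ, U₁ * majv 4 v = majv 4 v' * U₁) →
      IsUnit U₂.det → U₂ * parityOp = parityOp * U₂ →
        (∀ v : Fin 4 × Bool → ℂ, ∃ v' : Fin 4 × Bool → ℂ, U₂ * majv 4 v = majv 4 v' * U₂) →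
      ∀ (a₁ a₂ a₃ : ℂ) (u w : QReg 4 → ℂ), u ≠ 0 → w ≠ 0 →
        a₁ • U₁ + a₂ • U₂ + a₃ • (1 : Matrix (QReg 4) (QReg 4) ℂ) = vecMulVec u w →
          bilin u u = 0 ∧ bilin w w = 0 := by
  sorry

/-- **S5 `stub_facetStratum`** [L; strata `(4,4,k)`, `k ∈ {3,2,1,0e,0o}` — exactly ONE singular cut
matrix]. No even 3-term decomposition with nonzero coefficients in which exactly one term `z` has a singular
cut matrix. STATUS: PARTIAL on paper. Left-multiplying by `Ψ₂⁻¹` (S3) gives `a₁U + a₂·1 + a₃W = u mᵀ` with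
`U = tS ∈ Γ⁰` and `W = Ψ₂⁻¹ cut(z)` a SINGULAR element of `M̄⁰ = closure(Γ⁰)` (S3's corollary): its blocks
`W₊, W₋` have rank `2^{k-1}` each (`k ≥ 1`), totally isotropic images AND row spaces. Odd block:
`a₁tS₋ + a₂ = −a₃W₋` with `S₋ ∈ SO(Δ₋)`. Since `rank(S₋ + ν) ≥ 4` for `ν² ≠ 1` (isotropic eigenspace) and
`rank(S₋ ∓ 1)` is EVEN: `k ∈ {1, 0o}` (`rank W₋ = 1`) is impossible — the determinant obstruction of Disproof
§4(5); `k = 0e` (`W₋ = 0`) forces `S` central, `D = (a₁tε₊ + a₂)·1 + a₃ f f'ᵀ = u mᵀ`, so the scalar vanishes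
and `m ∥ f'` pure — dead; `k = 3` forces `S₋` of semisimple `(4/4)`-type (`ν² ≠ 1`, `ker W₋` Lagrangian) or
`±(1+N)`, `N ∈ [2⁴]` (`ν = ±1`: `im(S−1) = E₁^⊥` isotropic ⇒ `(S−1)² = 0`); `k = 2` forces `±(1+N)`,
`N ∈ [2²1⁴]`. Even block `D + a₃W₊ = u mᵀ`, `D := a₁tρ₊(s) + a₂`: THIS SEAT'S CHECK of what the isotropy of
`im W₊` / `row W₊` alone kills — `k = 3` semisimple `(1,6,1)`: rank `D ≤ 5` ⇒ `D` = 0 (then `W₊` rank 1 ≠ 4),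
a weight-line projector (rank `≤ 2 ≠ 4`) or the two corners (rank `≤ 3 ≠ 4`): DEAD; `k = 3` with `N₊ ∈ [3,1⁵]`:
`D = αN₊(1 + ½N₊)` of rank 2, `rank(umᵀ − D) ≤ 3 ≠ 4`: DEAD; `k = 2` semisimple is excluded upstream. What
SURVIVES the isotropy constraints (explicit consistent solutions for the pairings `β(m, ·)` exist): `k = 3`
with the `(4,4)` pattern (`D = d·P_Λ`, `u ∈ Λ`), `k = 3` with `N₊ ∈ [2⁴]` (`D = αN₊`, `u ∈ im N₊`), and
`k = 2` (`D = αN₊`, `N₊ ∈ [2²1⁴]`, `u ∈ im N₊`) — these need the COUPLING of `W₊` to `W₋` through the face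
normal form `W = x·e_k·y` (`x, y ∈ Γ⁰`, `e₃ =` "mode 1 empty", `e₂ =` "modes 1, 2 empty"; Putcha's
cross-section lattice): the fibre of `z ↦ (W₊, W₋)`, finite `8 × 8` linear algebra NOT yet written. WHY THE
STATE-LEVEL FORM: the matrix-level strengthening "`a₁U + a₂ + a₃W = u wᵀ ⇒ w null`" is equivalent by transpose
to "`⇒ u null`", and rank-one values with ONE non-null factor are not excluded in boundary configurations (see
S7) — only "`u` AND `w` non-null is impossible" is safe, and with `w = m` that is this statement. WHY IT MIGHT
STILL FAIL AS A LINE: only if the `(4,4,3)`/`(4,4,2)` fibre analysis hides a configuration — the crux itself is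
proved on paper by three other lines, so the STATEMENT is true. LEANS ON: S3's transport lemmas and corollary,
S4's spectral normal form, Putcha's cross-section lattice (faces of the 4-cube) for the normal form of `W`. -/
theorem stub_facetStratum :
    ∀ (a : Fin 3 → ℂ) (g : Fin 3 → QReg (2 * 4) → ℂ), (∀ i, IsGaussian (g i)) →
      (∀ i, evenProj (g i) = g i) → (∀ i, a i ≠ 0) →
        ∀ i₀ : Fin 3, ¬ IsUnit (cutMatrix (g i₀)).det →
          (∀ j : Fin 3, j ≠ i₀ → IsUnit (cutMatrix (g j)).det) →
            magicMPow 2 ≠ ∑ i, a i • g i := by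
  sorry

/-- **S6 `stub_oneInvertibleStratum`** [M/L; strata `(4,k,k')` — exactly ONE invertible cut matrix].
STATUS: reduced to ONE stratum on paper. Rank count (Disproof §4(5), last bullet): `½m mᵀ − a₁Ψ₁` has rank
`≥ 15` as a `16 × 16` matrix, while `rank(a₂Ψ₂ + a₃Ψ₃) ≤ 2^k + 2^{k'}`, so only `(4,3,3)` survives
(`8 + 8 ≥ 15`; every other pair of singular types has total rank `≤ 12`). In `(4,3,3)`, left-normalising by
`Ψ₁` gives `a₁·1 + a₂W₂ + a₃W₃ = u mᵀ` with two FACET monoid elements (`g·e₃·h`: Lagrangian image and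
kernel data in each chirality block); the odd block `a₁ + a₂W₂₋ + a₃W₃₋ = 0` with `rank W_{i,−} = 4` pins
`W₃₋ = −(a₁ + a₂W₂₋)/a₃`, so `a₁ + a₂W₂₋` has rank 4, i.e. `W₂₋` restricted suitably is "isoclinic"
(Disproof §4(6): `R + R⁻¹ = κ·1 + (rank ≤ 2)`) — the "partial similitudes of a face pair" computation of the
card, NOT done on paper. Same state-level caveat as S5. LEANS ON: S3 transport + corollary, rank
subadditivity (`Matrix.rank_add_le`), Putcha normal forms. -/
theorem stub_oneInvertibleStratum :
    ∀ (a : Fin 3 → ℂ) (g : Fin 3 → QReg (2 * 4) → ℂ), (∀ i, IsGaussian (g i)) →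
      (∀ i, evenProj (g i) = g i) → (∀ i, a i ≠ 0) →
        ∀ i₀ : Fin 3, IsUnit (cutMatrix (g i₀)).det →
          (∀ j : Fin 3, j ≠ i₀ → ¬ IsUnit (cutMatrix (g j)).det) →
            magicMPow 2 ≠ ∑ i, a i • g i := by
  sorry

/-- **S7 `stub_boundaryStratum`** [L/XL; HARDEST — no invertible cut matrix: all three terms on the
boundary `∂M̄` of the Clifford monoid]. STATUS: OPEN for this line (the card's "strata with ≥ 2 degenerate
terms are normalised by `G × G` instead of inverted; a finite list of face pairs, `8 × 8` linear algebra
each" — not carried out). Dead by hand already (Disproof §4(5), route review Lemma A): three product terms,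
`(3,3,0e)`, `(2,2,0e)`, `(2,2,0o)`; LIVE: `(3,3,3)`, `(3,3,2)`, `(3,3,1)`, `(3,2,2)`, `(2,2,2)`, `(2,2,1)`,
`(3,3,0o)` — each "≤ 3 isoclinic partial rotations `R + R⁻¹ = κ·1 + (rank ≤ 2)`" (Disproof §4(6)). No
division is available; the monoid structure enters through two-sided `CSpin(8) × CSpin(8)` normal forms
(Putcha: `M̄ = G·E(T̄)·G`, `E(T̄)` = face lattice of the weight 4-cube) and the target class
`{u wᵀ : u, w BOTH non-null}` being `G × G`-stable. WHY BOTH NON-NULLITIES ARE LOAD-BEARING HERE (this seat;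
a refuted strengthening for the disprover's file): rank-one values of boundary 3-term sums with ONE non-null
factor EXIST — for `f` pure and `m = n₁ + n₂` (two null vectors), `m fᵀ = n₁fᵀ + (n₂fᵀ − aΨ_g) + aΨ_g` with `g`
any Gaussian whose Lagrangian meets that of `n₂ ⊗ f` in dimension 6 (then the whole pencil through them is
Gaussian). Explicitly, on 8 qubits (block A = wires 0–3): `|0⁴0⁴⟩ + |1⁴0⁴⟩ (= √2·|M⟩⊗|0⁴⟩) = |0⁸⟩ +
[(1 − aβ)|1111 0000⟩ − aα|1110 0001⟩] + a[α|1110 0001⟩ + β|1111 0000⟩]`, three Gaussian terms (a basis state;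
two superpositions of basis states differing in exactly two bits = one hopping pair across the cut) of cut types
`(0e, 1, 1)`, all coefficients nonzero for generic `a, α, β`, while the cut matrix `m ⟨0⁴|` has the NON-null
column `m`; by transpose the same holds for rows. So neither "column null" nor "row null" is a theorem on the
boundary strata; only "not both non-null" is, which for the target `½ m mᵀ` is this statement. Two further dead
sub-moves recorded (NOTES of this seat): multiplying by an annihilating Majorana `c(k)`, `k ∈ K_A(Ψ₃)`, or by
the complementary facet idempotent `1 − e₃`, removes a term but turns the column `m` into a NULL vector (`c(k)m`
and `e₃'m = |1111⟩` are pure), landing in a true-and-useless 2-term identity. If the lead prefers, this stub is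
where another line's lever (lagrangian-triple-rigidity Case D/E: annihilator Lagrangians meeting / pairwise
transverse) is imported: both partition the same set of even decompositions. -/
theorem stub_boundaryStratum :
    ∀ (a : Fin 3 → ℂ) (g : Fin 3 → QReg (2 * 4) → ℂ), (∀ i, IsGaussian (g i)) →
      (∀ i, evenProj (g i) = g i) → (∀ i, a i ≠ 0) →
        (∀ i : Fin 3, ¬ IsUnit (cutMatrix (g i)).det) →
          magicMPow 2 ≠ ∑ i, a i • g i := by
  sorry

/-! ## §3 Composition lemmas (real proofs; no `sorry` below this line) -/

/-! ### Even projection (same lemmas as `Lines/e8-cartan-quotient.lean` §3, same vocabulary) -/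

theorem evenProj_add (φ ψ : QReg (2 * 4) → ℂ) : evenProj (φ + ψ) = evenProj φ + evenProj ψ := by
  funext x
  simp only [evenProj, Pi.add_apply]
  split_ifs <;> simp

theorem evenProj_smul (c : ℂ) (ψ : QReg (2 * 4) → ℂ) : evenProj (c • ψ) = c • evenProj ψ := by
  funext x
  simp only [evenProj, Pi.smul_apply, smul_eq_mul]
  split_ifs <;> simp

theorem evenProj_sum_three (f : Fin 3 → QReg (2 * 4) → ℂ) :
    evenProj (∑ i, f i) = ∑ i, evenProj (f i) := by
  rw [Fin.sum_univ_three, Fin.sum_univ_three, evenProj_add, evenProj_add]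

/-- Block-constant strings of eight bits have even weight (`decide` over the eight bits). -/
theorem card_even_of_blockConst_vec (b₀ b₁ b₂ b₃ b₄ b₅ b₆ b₇ : Bool) :
    (∀ k : Fin 2, ∀ i : Fin 4,
        (fun w : Fin (2 * 4) => ![b₀, b₁, b₂, b₃, b₄, b₅, b₆, b₇] w) (finProdFinEquiv (k, i)) =
          (fun w : Fin (2 * 4) => ![b₀, b₁, b₂, b₃, b₄, b₅, b₆, b₇] w) (finProdFinEquiv (k, (0 : Fin 4)))) →
      (Finset.univ.filter (fun i : Fin (2 * 4) =>
          (fun w : Fin (2 * 4) => ![b₀, b₁, b₂, b₃, b₄, b₅, b₆, b₇] w) i = true)).card % 2 = 0 := by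
  revert b₀ b₁ b₂ b₃ b₄ b₅ b₆ b₇
  decide

/-- Every label on `2 * 4` wires is the vector of its eight values. -/
theorem eq_vec8 (x : QReg (2 * 4)) :
    x = fun w : Fin (2 * 4) => ![x 0, x 1, x 2, x 3, x 4, x 5, x 6, x 7] w := by
  funext w
  fin_cases w <;> rfl

/-- Block-constant labels on `2 * 4` wires have even weight. -/
theorem card_even_of_blockConst (x : QReg (2 * 4))
    (hbc : ∀ k : Fin 2, ∀ i : Fin 4, x (finProdFinEquiv (k, i)) = x (finProdFinEquiv (k, (0 : Fin 4)))) :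
    (Finset.univ.filter (fun i : Fin (2 * 4) => x i = true)).card % 2 = 0 := by
  revert hbc
  rw [eq_vec8 x]
  exact card_even_of_blockConst_vec _ _ _ _ _ _ _ _

/-- `|M⟩^{⊗2}` is even. -/
theorem evenProj_magicMPow_two : evenProj (magicMPow 2) = magicMPow 2 := by
  classical
  funext x
  simp only [evenProj]
  split_ifs with hx
  · rfl
  · rw [magicMPow_apply, if_neg]
    intro hbc
    exact hx (card_even_of_blockConst x hbc)

/-- The vacuum `|0⁸⟩` is even. -/
theorem evenProj_zeroState : evenProj (zeroState (2 * 4)) = zeroState (2 * 4) := by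
  funext x
  simp only [evenProj]
  split_ifs with hx
  · rfl
  · rw [zeroState, basisState_apply, if_neg]
    intro h
    apply hx
    rw [h]
    decide

/-- S1 ⇒ the even projection of ANY 3-term Gaussian combination is a 3-term combination of EVEN
Gaussian states (odd terms are replaced by `0 • |0⁸⟩`). -/
theorem even_redecomposition
    (h1 : ∀ g : QReg (2 * 4) → ℂ, IsGaussian g → evenProj g = g ∨ evenProj g = 0)
    (a : Fin 3 → ℂ) (g : Fin 3 → QReg (2 * 4) → ℂ) (hg : ∀ i, IsGaussian (g i)) :
    ∃ (a' : Fin 3 → ℂ) (g' : Fin 3 → QReg (2 * 4) → ℂ), (∀ i, IsGaussian (g' i)) ∧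
      (∀ i, evenProj (g' i) = g' i) ∧ ∑ i, a' i • g' i = evenProj (∑ i, a i • g i) := by
  classical
  refine ⟨fun i => if evenProj (g i) = g i then a i else 0,
    fun i => if evenProj (g i) = g i then g i else zeroState (2 * 4), ?_, ?_, ?_⟩
  · intro i
    by_cases h : evenProj (g i) = g i
    · simp only [if_pos h]; exact hg i
    · simp only [if_neg h]; exact zeroState_isGaussian _
  · intro i
    by_cases h : evenProj (g i) = g i
    · simp only [if_pos h]; exact h
    · simp only [if_neg h]; exact evenProj_zeroState
  · rw [evenProj_sum_three]
    refine Finset.sum_congr rfl fun i _ => ?_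
    rw [evenProj_smul]
    by_cases h : evenProj (g i) = g i
    · simp only [if_pos h]; rw [h]
    · have h0 : evenProj (g i) = 0 := (h1 (g i) (hg i)).resolve_left h
      simp only [if_neg h]; rw [h0, smul_zero, zero_smul]

/-! ### Dropping a term with zero coefficient: down to S2 -/

/-- A 3-term decomposition with a vanishing coefficient is a 2-term decomposition (`Fin.sum_univ_succAbove`),
excluded by S2. -/
theorem false_of_zero_coeff
    (h2 : ∀ (b : Fin 2 → ℂ) (h : Fin 2 → QReg (2 * 4) → ℂ), (∀ i, IsGaussian (h i)) →
      magicMPow 2 ≠ ∑ i, b i • h i)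
    (a : Fin 3 → ℂ) (g : Fin 3 → QReg (2 * 4) → ℂ) (hg : ∀ i, IsGaussian (g i)) (i₀ : Fin 3)
    (h0 : a i₀ = 0) (heq : magicMPow 2 = ∑ i, a i • g i) : False := by
  rw [Fin.sum_univ_succAbove _ i₀, h0, zero_smul, zero_add] at heq
  exact h2 (fun j => a (i₀.succAbove j)) (fun j => g (i₀.succAbove j)) (fun j => hg _) heq

/-! ### The four-way split of a triple by the number of invertible cut matrices -/

theorem fin3_all (q : Fin 3 → Prop) (h0 : q 0) (h1 : q 1) (h2 : q 2) : ∀ i, q i := by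
  intro i
  fin_cases i <;> assumption

/-- Three Booleans: all true / exactly one false / exactly one true / all false. -/
theorem fin3_split (p : Fin 3 → Prop) :
    (∀ i, p i) ∨ (∃ i, ¬ p i ∧ ∀ j, j ≠ i → p j) ∨ (∃ i, p i ∧ ∀ j, j ≠ i → ¬ p j) ∨ (∀ i, ¬ p i) := by
  by_cases h0 : p 0 <;> by_cases h1 : p 1 <;> by_cases h2 : p 2
  · exact Or.inl (fin3_all p h0 h1 h2)
  · exact Or.inr (Or.inl ⟨2, h2, fin3_all (fun j => j ≠ 2 → p j)
      (fun _ => h0) (fun _ => h1) (fun h => absurd rfl h)⟩)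
  · exact Or.inr (Or.inl ⟨1, h1, fin3_all (fun j => j ≠ 1 → p j)
      (fun _ => h0) (fun h => absurd rfl h) (fun _ => h2)⟩)
  · exact Or.inr (Or.inr (Or.inl ⟨0, h0, fin3_all (fun j => j ≠ 0 → ¬ p j)
      (fun h => absurd rfl h) (fun _ => h1) (fun _ => h2)⟩))
  · exact Or.inr (Or.inl ⟨0, h0, fin3_all (fun j => j ≠ 0 → p j)
      (fun h => absurd rfl h) (fun _ => h1) (fun _ => h2)⟩)
  · exact Or.inr (Or.inr (Or.inl ⟨1, h1, fin3_all (fun j => j ≠ 1 → ¬ p j)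
      (fun _ => h0) (fun h => absurd rfl h) (fun _ => h2)⟩))
  · exact Or.inr (Or.inr (Or.inl ⟨2, h2, fin3_all (fun j => j ≠ 2 → ¬ p j)
      (fun _ => h0) (fun _ => h1) (fun h => absurd rfl h)⟩))
  · exact Or.inr (Or.inr (Or.inr (fin3_all (fun j => ¬ p j) h0 h1 h2)))

/-! ### Cut matrices: linearity and the cut matrix of `|M⟩^{⊗2}` -/

theorem cutMatrix_add (ψ φ : QReg (2 * 4) → ℂ) : cutMatrix (ψ + φ) = cutMatrix ψ + cutMatrix φ := by
  ext x y
  simp [cutMatrix]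

theorem cutMatrix_smul (c : ℂ) (ψ : QReg (2 * 4) → ℂ) : cutMatrix (c • ψ) = c • cutMatrix ψ := by
  ext x y
  simp [cutMatrix]

theorem cutMatrix_sum_three (a : Fin 3 → ℂ) (g : Fin 3 → QReg (2 * 4) → ℂ) :
    cutMatrix (∑ i, a i • g i) =
      a 0 • cutMatrix (g 0) + a 1 • cutMatrix (g 1) + a 2 • cutMatrix (g 2) := by
  rw [Fin.sum_univ_three, cutMatrix_add, cutMatrix_add, cutMatrix_smul, cutMatrix_smul, cutMatrix_smul]

/-- Every label on `4` wires is the vector of its four values. -/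
theorem eq_vec4 (x : QReg 4) : x = fun w : Fin 4 => ![x 0, x 1, x 2, x 3] w := by
  funext w
  fin_cases w <;> rfl

/-- A glued label is block-constant iff both halves are constant (`decide` over the eight bits). -/
theorem blockConst_glue_vec (x₀ x₁ x₂ x₃ y₀ y₁ y₂ y₃ : Bool) :
    (∀ k : Fin 2, ∀ i : Fin 4,
        glue (fun w : Fin 4 => ![x₀, x₁, x₂, x₃] w) (fun w : Fin 4 => ![y₀, y₁, y₂, y₃] w)
            (finProdFinEquiv (k, i)) =
          glue (fun w : Fin 4 => ![x₀, x₁, x₂, x₃] w) (fun w : Fin 4 => ![y₀, y₁, y₂, y₃] w)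
            (finProdFinEquiv (k, (0 : Fin 4)))) ↔
      ((∀ i : Fin 4, (fun w : Fin 4 => ![x₀, x₁, x₂, x₃] w) i = (fun w : Fin 4 => ![x₀, x₁, x₂, x₃] w) 0) ∧
        (∀ i : Fin 4, (fun w : Fin 4 => ![y₀, y₁, y₂, y₃] w) i = (fun w : Fin 4 => ![y₀, y₁, y₂, y₃] w) 0)) := by
  revert x₀ x₁ x₂ x₃ y₀ y₁ y₂ y₃
  decide

theorem blockConst_glue_iff (x y : QReg 4) :
    (∀ k : Fin 2, ∀ i : Fin 4, glue x y (finProdFinEquiv (k, i)) = glue x y (finProdFinEquiv (k, (0 : Fin 4)))) ↔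
      ((∀ i : Fin 4, x i = x 0) ∧ (∀ i : Fin 4, y i = y 0)) := by
  rw [eq_vec4 x, eq_vec4 y]
  exact blockConst_glue_vec _ _ _ _ _ _ _ _

/-- Amplitudes of `m = |0000⟩ + |1111⟩`. -/
theorem mvec_apply (x : QReg 4) [Decidable (∀ i : Fin 4, x i = x 0)] :
    mvec x = if (∀ i : Fin 4, x i = x 0) then 1 else 0 := by
  simp only [mvec, Pi.add_apply, basisState_apply]
  have hne : (fun _ : Fin 4 => false) ≠ (fun _ => true) := fun h => Bool.false_ne_true (congrFun h 0)
  by_cases h : ∀ i : Fin 4, x i = x 0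
  · rw [if_pos h]
    obtain ⟨c, rfl⟩ : ∃ c, x = fun _ => c := ⟨x 0, funext h⟩
    cases c <;> simp [hne, hne.symm]
  · rw [if_neg h]
    have h0 : x ≠ fun _ => false := fun hx => h fun i => by rw [hx]
    have h1 : x ≠ fun _ => true := fun hx => h fun i => by rw [hx]
    simp [h0, h1]

theorem mvec_ne_zero : mvec ≠ 0 := by
  intro h
  have h0 := congrFun h (fun _ => false)
  have hne : (fun _ : Fin 4 => false) ≠ (fun _ => true) := fun h => Bool.false_ne_true (congrFun h 0)
  simp [mvec, hne] at h0

/-- **The cut matrix of `|M⟩^{⊗2}` is the rank-one matrix `½ m mᵀ`.** -/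
theorem cutMatrix_magicMPow_two :
    cutMatrix (magicMPow 2) = (((Real.sqrt 2 : ℂ)⁻¹) ^ 2) • vecMulVec mvec mvec := by
  classical
  ext x y
  simp only [cutMatrix, Matrix.of_apply, Matrix.smul_apply, vecMulVec_apply, smul_eq_mul]
  rw [magicMPow_apply, mvec_apply, mvec_apply]
  have hiff := blockConst_glue_iff x y
  by_cases hb : ∀ k : Fin 2, ∀ i : Fin 4,
      glue x y (finProdFinEquiv (k, i)) = glue x y (finProdFinEquiv (k, (0 : Fin 4)))
  · obtain ⟨hx, hy⟩ := hiff.mp hb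
    rw [if_pos hb, if_pos hx, if_pos hy]
    ring
  · rw [if_neg hb]
    by_cases hx : ∀ i : Fin 4, x i = x 0
    · have hy : ¬ ∀ i : Fin 4, y i = y 0 := fun hy => hb (hiff.mpr ⟨hx, hy⟩)
      rw [if_neg hy]
      ring
    · rw [if_neg hx]
      ring

/-! ### Rank-one matrices under left multiplication -/

theorem mul_vecMulVec {m n l : Type*} [Fintype m] [Fintype n] (A : Matrix l m ℂ) (u : m → ℂ) (w : n → ℂ) :
    A * vecMulVec u w = vecMulVec (A *ᵥ u) w := by
  ext i j
  simp only [Matrix.mul_apply, vecMulVec_apply, Matrix.mulVec, dotProduct, Finset.sum_mul]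
  refine Finset.sum_congr rfl fun k _ => ?_
  ring

theorem smul_vecMulVec' {m n : Type*} (c : ℂ) (u : m → ℂ) (w : n → ℂ) :
    c • vecMulVec u w = vecMulVec (c • u) w := by
  ext i j
  simp only [Matrix.smul_apply, vecMulVec_apply, Pi.smul_apply, smul_eq_mul]
  ring

/-! ### `β(m, m) = -2`: the GHZ₄ vector is NOT null (⇔ `|M⟩` is not Gaussian) -/

theorem sum_mvec_mul (f : QReg 4 → ℂ) :
    ∑ x, mvec x * f x = f (fun _ => false) + f (fun _ => true) := by
  simp only [mvec, Pi.add_apply, basisState_apply, add_mul, Finset.sum_add_distrib, ite_mul, one_mul,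
    zero_mul, Finset.sum_ite_eq', Finset.mem_univ, if_true]

theorem chargeConj_mulVec_mvec (y : QReg 4) :
    (chargeConj *ᵥ mvec) y = chargeConj y (fun _ => false) + chargeConj y (fun _ => true) := by
  simp only [Matrix.mulVec, dotProduct]
  simp_rw [mul_comm (chargeConj y _) (mvec _)]
  exact sum_mvec_mul _

theorem bilin_mvec : bilin mvec mvec = -2 := by
  unfold bilin
  simp only [dotProduct]
  rw [sum_mvec_mul, chargeConj_mulVec_mvec, chargeConj_mulVec_mvec]
  have chargeConj_apply : ∀ x y : QReg 4,
      chargeConj x y = ∏ i : Fin 4, (![Pauli.X, Pauli.Y, Pauli.X, Pauli.Y] i).mat (x i) (y i) :=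
    fun _ _ => rfl
  simp only [chargeConj_apply, Fin.prod_univ_four, Matrix.cons_val_zero, Matrix.cons_val_one,
    Matrix.head_cons, Matrix.cons_val_two, Matrix.tail_cons, Matrix.cons_val_three,
    Pauli.mat_X_apply, Pauli.mat_Y_apply]
  simp
  ring_nf

/-! ### The TOP STRATUM from S3 + S4 (the card's `TopStratumFree`, now a composition lemma) -/

theorem sqrt_two_ne_zero' : (Real.sqrt 2 : ℂ) ≠ 0 :=
  Complex.ofReal_ne_zero.mpr (Real.sqrt_ne_zero'.mpr (by norm_num))

/-- **Top stratum (4,4,4).** If all three cut matrices are invertible there is no decomposition: cut the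
equation to `Σ aᵢΨᵢ = ½ m mᵀ`, left-multiply by `Ψ₂⁻¹` to get the pencil `a₀U₀ + a₁U₁ + a₂·1 =
(½Ψ₂⁻¹m) mᵀ` with `U₀, U₁ ∈ Γ⁰` (S3), and S4 makes the ROW `m` null — but `β(m,m) = -2`. -/
theorem topStratum_of
    (h3 : ∀ g g' : QReg (2 * 4) → ℂ, IsGaussian g → IsGaussian g' → evenProj g = g → evenProj g' = g' →
      IsUnit (cutMatrix g).det → IsUnit (cutMatrix g').det →
        ((cutMatrix g')⁻¹ * cutMatrix g) * parityOp = parityOp * ((cutMatrix g')⁻¹ * cutMatrix g) ∧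
          ∀ v : Fin 4 × Bool → ℂ, ∃ v' : Fin 4 × Bool → ℂ,
            ((cutMatrix g')⁻¹ * cutMatrix g) * majv 4 v = majv 4 v' * ((cutMatrix g')⁻¹ * cutMatrix g))
    (h4 : ∀ (U₁ U₂ : Matrix (QReg 4) (QReg 4) ℂ),
      IsUnit U₁.det → U₁ * parityOp = parityOp * U₁ →
        (∀ v : Fin 4 × Bool → ℂ, ∃ v' : Fin 4 × Bool → ℂ, U₁ * majv 4 v = majv 4 v' * U₁) →
      IsUnit U₂.det → U₂ * parityOp = parityOp * U₂ →
        (∀ v : Fin 4 × Bool → ℂ, ∃ v' : Fin 4 × Bool → ℂ, U₂ * majv 4 v = majv 4 v' * U₂) →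
      ∀ (a₁ a₂ a₃ : ℂ) (u w : QReg 4 → ℂ), u ≠ 0 → w ≠ 0 →
        a₁ • U₁ + a₂ • U₂ + a₃ • (1 : Matrix (QReg 4) (QReg 4) ℂ) = vecMulVec u w →
          bilin u u = 0 ∧ bilin w w = 0)
    (a : Fin 3 → ℂ) (g : Fin 3 → QReg (2 * 4) → ℂ) (hg : ∀ i, IsGaussian (g i))
    (he : ∀ i, evenProj (g i) = g i) (hU : ∀ i, IsUnit (cutMatrix (g i)).det)
    (heq : magicMPow 2 = ∑ i, a i • g i) : False := by
  have hc : (((Real.sqrt 2 : ℂ)⁻¹) ^ 2) ≠ 0 := pow_ne_zero _ (inv_ne_zero sqrt_two_ne_zero')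
  -- cut the equation
  have hcut : (((Real.sqrt 2 : ℂ)⁻¹) ^ 2) • vecMulVec mvec mvec =
      a 0 • cutMatrix (g 0) + a 1 • cutMatrix (g 1) + a 2 • cutMatrix (g 2) := by
    rw [← cutMatrix_magicMPow_two, heq, cutMatrix_sum_three]
  -- normalise by the third term
  have hinv : (cutMatrix (g 2))⁻¹ * cutMatrix (g 2) = 1 := Matrix.nonsing_inv_mul _ (hU 2)
  have key : a 0 • ((cutMatrix (g 2))⁻¹ * cutMatrix (g 0)) + a 1 • ((cutMatrix (g 2))⁻¹ * cutMatrix (g 1)) +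
      a 2 • (1 : Matrix (QReg 4) (QReg 4) ℂ) =
        vecMulVec ((((Real.sqrt 2 : ℂ)⁻¹) ^ 2) • ((cutMatrix (g 2))⁻¹ *ᵥ mvec)) mvec := by
    have h := congrArg (fun X => (cutMatrix (g 2))⁻¹ * X) hcut
    simp only [Matrix.mul_add, Matrix.mul_smul, hinv] at h
    rw [mul_vecMulVec, smul_vecMulVec'] at h
    exact h.symm
  have hm : mvec ≠ 0 := mvec_ne_zero
  have hu : (((Real.sqrt 2 : ℂ)⁻¹) ^ 2) • ((cutMatrix (g 2))⁻¹ *ᵥ mvec) ≠ 0 := by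
    intro h0
    have h1 : (cutMatrix (g 2))⁻¹ *ᵥ mvec = 0 := (smul_eq_zero.mp h0).resolve_left hc
    have h2 : cutMatrix (g 2) *ᵥ ((cutMatrix (g 2))⁻¹ *ᵥ mvec) = mvec := by
      rw [Matrix.mulVec_mulVec, Matrix.mul_nonsing_inv _ (hU 2), Matrix.one_mulVec]
    rw [h1, Matrix.mulVec_zero] at h2
    exact hm h2.symm
  -- the two relative operators are in `Γ⁰` (S3) and invertible (`det_mul`)
  obtain ⟨hP0, hN0⟩ := h3 (g 0) (g 2) (hg 0) (hg 2) (he 0) (he 2) (hU 0) (hU 2)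
  obtain ⟨hP1, hN1⟩ := h3 (g 1) (g 2) (hg 1) (hg 2) (he 1) (he 2) (hU 1) (hU 2)
  have hD0 : IsUnit ((cutMatrix (g 2))⁻¹ * cutMatrix (g 0)).det := by
    rw [Matrix.det_mul]
    exact (Matrix.isUnit_nonsing_inv_det _ (hU 2)).mul (hU 0)
  have hD1 : IsUnit ((cutMatrix (g 2))⁻¹ * cutMatrix (g 1)).det := by
    rw [Matrix.det_mul]
    exact (Matrix.isUnit_nonsing_inv_det _ (hU 2)).mul (hU 1)
  have hrow := (h4 _ _ hD0 hP0 hN0 hD1 hP1 hN1 (a 0) (a 1) (a 2) _ _ hu hm key).2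
  rw [bilin_mvec] at hrow
  norm_num at hrow

/-! ### All stubs together prove `χ_G(M⊗M) ≥ 4` (named form) -/

/-- The seven stub STATEMENTS imply the named form of the crux. Flow: S1 even re-decomposition →
a zero coefficient is a 2-term decomposition (S2) → otherwise split by the number of invertible cut
matrices: 3 ⇒ top stratum (S3 + S4, `topStratum_of`), 2 ⇒ S5, 1 ⇒ S6, 0 ⇒ S7. -/
theorem crux_of_stubs
    (h1 : ∀ g : QReg (2 * 4) → ℂ, IsGaussian g → evenProj g = g ∨ evenProj g = 0)
    (h2 : ∀ (b : Fin 2 → ℂ) (h : Fin 2 → QReg (2 * 4) → ℂ), (∀ i, IsGaussian (h i)) →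
      magicMPow 2 ≠ ∑ i, b i • h i)
    (h3 : ∀ g g' : QReg (2 * 4) → ℂ, IsGaussian g → IsGaussian g' → evenProj g = g → evenProj g' = g' →
      IsUnit (cutMatrix g).det → IsUnit (cutMatrix g').det →
        ((cutMatrix g')⁻¹ * cutMatrix g) * parityOp = parityOp * ((cutMatrix g')⁻¹ * cutMatrix g) ∧
          ∀ v : Fin 4 × Bool → ℂ, ∃ v' : Fin 4 × Bool → ℂ,
            ((cutMatrix g')⁻¹ * cutMatrix g) * majv 4 v = majv 4 v' * ((cutMatrix g')⁻¹ * cutMatrix g))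
    (h4 : ∀ (U₁ U₂ : Matrix (QReg 4) (QReg 4) ℂ),
      IsUnit U₁.det → U₁ * parityOp = parityOp * U₁ →
        (∀ v : Fin 4 × Bool → ℂ, ∃ v' : Fin 4 × Bool → ℂ, U₁ * majv 4 v = majv 4 v' * U₁) →
      IsUnit U₂.det → U₂ * parityOp = parityOp * U₂ →
        (∀ v : Fin 4 × Bool → ℂ, ∃ v' : Fin 4 × Bool → ℂ, U₂ * majv 4 v = majv 4 v' * U₂) →
      ∀ (a₁ a₂ a₃ : ℂ) (u w : QReg 4 → ℂ), u ≠ 0 → w ≠ 0 →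
        a₁ • U₁ + a₂ • U₂ + a₃ • (1 : Matrix (QReg 4) (QReg 4) ℂ) = vecMulVec u w →
          bilin u u = 0 ∧ bilin w w = 0)
    (h5 : ∀ (a : Fin 3 → ℂ) (g : Fin 3 → QReg (2 * 4) → ℂ), (∀ i, IsGaussian (g i)) →
      (∀ i, evenProj (g i) = g i) → (∀ i, a i ≠ 0) →
        ∀ i₀ : Fin 3, ¬ IsUnit (cutMatrix (g i₀)).det →
          (∀ j : Fin 3, j ≠ i₀ → IsUnit (cutMatrix (g j)).det) →
            magicMPow 2 ≠ ∑ i, a i • g i)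
    (h6 : ∀ (a : Fin 3 → ℂ) (g : Fin 3 → QReg (2 * 4) → ℂ), (∀ i, IsGaussian (g i)) →
      (∀ i, evenProj (g i) = g i) → (∀ i, a i ≠ 0) →
        ∀ i₀ : Fin 3, IsUnit (cutMatrix (g i₀)).det →
          (∀ j : Fin 3, j ≠ i₀ → ¬ IsUnit (cutMatrix (g j)).det) →
            magicMPow 2 ≠ ∑ i, a i • g i)
    (h7 : ∀ (a : Fin 3 → ℂ) (g : Fin 3 → QReg (2 * 4) → ℂ), (∀ i, IsGaussian (g i)) →
      (∀ i, evenProj (g i) = g i) → (∀ i, a i ≠ 0) →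
        (∀ i : Fin 3, ¬ IsUnit (cutMatrix (g i)).det) →
          magicMPow 2 ≠ ∑ i, a i • g i)
    (a : Fin 3 → ℂ) (g : Fin 3 → QReg (2 * 4) → ℂ) (hg : ∀ i, IsGaussian (g i))
    (heq : magicMPow 2 = ∑ i, a i • g i) : False := by
  classical
  obtain ⟨a', g', hg', he', hsum⟩ := even_redecomposition h1 a g hg
  have heq' : magicMPow 2 = ∑ i, a' i • g' i := by
    rw [hsum, ← heq, evenProj_magicMPow_two]
  by_cases hz : ∃ i, a' i = 0
  · obtain ⟨i₀, hi₀⟩ := hz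
    exact false_of_zero_coeff h2 a' g' hg' i₀ hi₀ heq'
  · push Not at hz
    rcases fin3_split (fun i => IsUnit (cutMatrix (g' i)).det) with hall | ⟨i₀, hn, hy⟩ | ⟨i₀, hy, hn⟩ | hnone
    · exact topStratum_of h3 h4 a' g' hg' he' hall heq'
    · exact h5 a' g' hg' he' hz i₀ hn hy heq'
    · exact h6 a' g' hg' he' hz i₀ hy hn heq'
    · exact h7 a' g' hg' he' hz hnone heq'

/-! ## §4 The skeleton theorem: the seven stubs prove the crux BY NAME -/

/-- **`GaussRankTwoCopies` from the seven registered stubs.** The route decl unfolds (three `let`s,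
`Iff.rfl`-identical to the named API: Disproof §0 `crux_iff`) to
`∀ a g, (∀ i, IsGaussian (g i)) → magicMPow 2 ≠ Σ aᵢ • gᵢ`; `crux_of_stubs` is that statement. The only
gaps the audit sees are the seven `sorry`s of §2. -/
theorem GaussRankTwoCopies_of :
    Summit.QuantumAdvantage.QuantumAdvantage.Theses.SpinorFlattening.GaussRankTwoCopies := by
  intro a g hg heq
  have hg' : ∀ i, IsGaussian (g i) := hg
  have heq' : magicMPow 2 = ∑ i, a i • g i := heq
  exact crux_of_stubs stub_gaussianParity stub_twoTermFree stub_cutCliffordGroup stub_pencil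
    stub_facetStratum stub_oneInvertibleStratum stub_boundaryStratum a g hg' heq'

end Summit.QuantumAdvantage.QuantumAdvantage.Cruxes.GaussRankTwoCopies.CliffordMonoidPencil

end
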